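import Literature.MathematicalPhysics.QuantumLattice.PeriodicVariationalEquilibria
import HarnessLib

/-!
# The periodic variational pressure as a function of the couplings: convexity, Lipschitz bounds, and the
# closed graph of the periodic equilibrium correspondence

Periodic (superlattice `L_q`) twin of `TIVariationalPressure` §2–§2b and `VariationalEquilibriumStability`, for the periodic
variational pressure `P_q(β, Ψ) = sup_{ω q-periodic} [s̄(ω) − β ē_q(Ψ)(ω)]` of `PeriodicVariationalPressure`:

* §1 comparison: `|P_q(β,Ψ) − P_q(β,Ψ')| ≤ |β|·C` whenever `|ē_q(Ψ)(ω) − ē_q(Ψ')(ω)| ≤ C` on periodic states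
  (`abs_perVarPressure_sub_le`); monotonicity (`perVarPressure_anti`); **Lipschitz in `β`**:
  `|P_q(β) − P_q(β')| ≤ |β − β'| S_q(Ψ)` (`abs_perVarPressure_sub_perVarPressure_beta_le`) and sequential continuity.
* §2 linear families `Ψ(θ) = Ψ₀ + Σ θ_a Ψ_a`: **`θ ↦ P_q(β, Ψ(θ))` is CONVEX** (`convexOn_perVarPressure_linearFamily`) and **jointly Lipschitz**,
  `|P_q(θ) − P_q(θ')| ≤ |β| Σ_a |θ_a − θ'_a| S_q(Ψ_a)` (`abs_perVarPressure_linearFamily_sub_le`); joint sequential continuity in `(β, θ)`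
  (`tendsto_perVarPressure_of_tendsto`). USE: pressures certified on a grid of couplings (aligned boxes, `PeriodicGibbsVariationalPrinciple`)
  extend to certified two-sided bounds BETWEEN grid points (Lipschitz above, convexity below along segments).
* §3 **CLOSED GRAPH of the periodic equilibrium correspondence**: periodic equilibrium states at `(β_k, Ψ_k)` converging locally, with
  `β_k → β`, `P_q(β_k,Ψ_k) → P_q(β,Ψ)` and `ē(Ψ_k)(ω_k) − ē(Ψ)(ω_k) → 0`, converge to a periodic equilibrium state at `(β, Ψ)`
  (`isPerVarEquilibrium_of_tendsto_general`); specialisations in `β` alone and in `(β, θ)` for linear families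
  (`isPerVarEquilibrium_of_tendsto_params`) — the closedness of a `T > 0` phase diagram drawn with periodic (e.g. antiferromagnetic,
  charge-density-wave, decorated-cell) order parameters.
* §4 entropy density of a periodic equilibrium state from three pressures (`IsPerVarEquilibrium.entropyDensitySup_mem_Icc`).

Everything is PROVED; no definition, no named fact, no number.

## Tree / Mathlib search

REUSED: `perVarPressure`, `sub_mul_le_perVarPressure`, `perVarPressure_le`, `cellSiteNorm`, `abs_cellMeanEnergy_le_cellSiteNorm`
(`PeriodicVariationalPressure`); `IsPerVarEquilibrium`, `cellMeanEnergy_linearFamily(_eq_add_sum_sub_mul)`, `tendsto_cellMeanEnergy_of_tendsto_expect`,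
`isPerVarEquilibrium_of_tendsto_expect_of_tendsto`, `IsPerVarEquilibrium.cellMeanEnergy_mem_Icc_beta` (`PeriodicVariationalEquilibria`); the TI originals
`abs_varPressure_sub_le`, `convexOn_varPressure_linearFamily`, `isVarEquilibrium_of_tendsto_general` (patterns). `lean search 'perVarPressure convex|perVarPressure Lipschitz'`
(2026-08-28): only `convexOn_perVarPressure_beta`.

## References

* R. B. Israel, *Convexity in the Theory of Lattice Gases* (1979), Thm. I.2.4, Thm. I.3.4 (the pressure is convex and Lipschitz on the space of interactions).
* O. Bratteli, D. W. Robinson, *OAQSM 2* (1997), Thm. 6.2.40.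
-/

noncomputable section

open scoped ComplexOrder BigOperators
open Finset Filter Topology

namespace Literature.MathematicalPhysics.QuantumLattice

open Matrix HubbardWave0 Literature.Probability.LatticeModels ThermodynamicLimit

variable {d : ℕ}

/-! ### §1. Comparison, monotonicity, Lipschitz continuity in `β` -/

namespace FermionInteraction

variable (β : ℝ) (q : Fin d → ℕ) (Ψ : FermionInteraction d) (R : ℝ)

/-- **COMPARISON / LIPSCHITZ**: if `|ē_q(Ψ)(ω) − ē_q(Ψ')(ω)| ≤ C` for every `q`-periodic `ω` then `|P_q(β,Ψ) − P_q(β,Ψ')| ≤ |β|·C`.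
[cite: Israel1979, Thm. I.3.4] -/
theorem abs_perVarPressure_sub_le (Ψ' : FermionInteraction d) (R' : ℝ) {C : ℝ}
    (h : ∀ ω : InfVolFermionState d, ω.IsPeriodic q →
      |InfVolFermionState.cellMeanEnergy q Ψ ω R - InfVolFermionState.cellMeanEnergy q Ψ' ω R'| ≤ C) :
    |Ψ.perVarPressure β q R - Ψ'.perVarPressure β q R'| ≤ |β| * C := by
  rw [abs_le]
  constructor
  · have : Ψ'.perVarPressure β q R' ≤ Ψ.perVarPressure β q R + |β| * C := by
      refine Ψ'.perVarPressure_le β q R' fun ω hω => ?_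
      have h1 := Ψ.sub_mul_le_perVarPressure β q R hω
      have h2 : β * InfVolFermionState.cellMeanEnergy q Ψ ω R - β * InfVolFermionState.cellMeanEnergy q Ψ' ω R' ≤ |β| * C := by
        rw [← mul_sub]
        exact (le_abs_self _).trans (by rw [abs_mul]; exact mul_le_mul_of_nonneg_left (h ω hω) (abs_nonneg β))
      linarith
    linarith
  · have : Ψ.perVarPressure β q R ≤ Ψ'.perVarPressure β q R' + |β| * C := by
      refine Ψ.perVarPressure_le β q R fun ω hω => ?_
      have h1 := Ψ'.sub_mul_le_perVarPressure β q R' hω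
      have h2 : β * InfVolFermionState.cellMeanEnergy q Ψ' ω R' - β * InfVolFermionState.cellMeanEnergy q Ψ ω R ≤ |β| * C := by
        rw [← mul_sub]
        refine (le_abs_self _).trans ?_
        rw [abs_mul, abs_sub_comm]
        exact mul_le_mul_of_nonneg_left (h ω hω) (abs_nonneg β)
      linarith
    linarith

/-- **Monotonicity**: if `ē_q(Ψ)(ω) ≤ ē_q(Ψ')(ω)` on periodic states and `β ≥ 0` then `P_q(β,Ψ') ≤ P_q(β,Ψ)`. [cite: Israel1979, Thm. I.3.4] -/
theorem perVarPressure_anti (Ψ' : FermionInteraction d) (R' : ℝ) (hβ : 0 ≤ β)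
    (h : ∀ ω : InfVolFermionState d, ω.IsPeriodic q →
      InfVolFermionState.cellMeanEnergy q Ψ ω R ≤ InfVolFermionState.cellMeanEnergy q Ψ' ω R') :
    Ψ'.perVarPressure β q R' ≤ Ψ.perVarPressure β q R := by
  refine Ψ'.perVarPressure_le β q R' fun ω hω => ?_
  have h1 := Ψ.sub_mul_le_perVarPressure β q R hω
  nlinarith [h ω hω]

variable {β}

/-- **`|P_q(β,Ψ) − P_q(β',Ψ)| ≤ |β − β'|·S_q(Ψ)`**: Lipschitz in the inverse temperature. [cite: Israel1979, Thm. I.3.4] -/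
theorem abs_perVarPressure_sub_perVarPressure_beta_le (β β' : ℝ) :
    |Ψ.perVarPressure β q R - Ψ.perVarPressure β' q R| ≤ |β - β'| * Ψ.cellSiteNorm q R := by
  have key : ∀ b b' : ℝ, Ψ.perVarPressure b q R ≤ Ψ.perVarPressure b' q R + |b - b'| * Ψ.cellSiteNorm q R := by
    intro b b'
    refine Ψ.perVarPressure_le b q R fun ω hω => ?_
    have h1 := Ψ.sub_mul_le_perVarPressure b' q R hω
    have h2 : b' * InfVolFermionState.cellMeanEnergy q Ψ ω R - b * InfVolFermionState.cellMeanEnergy q Ψ ω R ≤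
        |b - b'| * Ψ.cellSiteNorm q R := by
      rw [← sub_mul, show (b' - b) * InfVolFermionState.cellMeanEnergy q Ψ ω R = -((b - b') * InfVolFermionState.cellMeanEnergy q Ψ ω R) by ring]
      refine (neg_le_abs _).trans ?_
      rw [abs_mul]
      exact mul_le_mul_of_nonneg_left (Ψ.abs_cellMeanEnergy_le_cellSiteNorm q R ω) (abs_nonneg _)
    linarith
  rw [abs_le]
  constructor
  · have h := key β' β
    rw [abs_sub_comm] at h
    linarith
  · linarith [key β β']

/-- `β ↦ P_q(β,Ψ)` is continuous (sequential form). [cite: Israel1979, Thm. I.3.4] -/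
theorem tendsto_perVarPressure_beta {βs : ℕ → ℝ} {β : ℝ} (hβ : Tendsto βs atTop (𝓝 β)) :
    Tendsto (fun k => Ψ.perVarPressure (βs k) q R) atTop (𝓝 (Ψ.perVarPressure β q R)) := by
  rw [tendsto_iff_norm_sub_tendsto_zero]
  have h0 : Tendsto (fun k => |βs k - β| * Ψ.cellSiteNorm q R) atTop (𝓝 0) := by
    have h := (tendsto_iff_norm_sub_tendsto_zero.1 hβ).mul_const (Ψ.cellSiteNorm q R)
    rw [zero_mul] at h
    exact h
  exact squeeze_zero (fun k => norm_nonneg _) (fun k => by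
    rw [Real.norm_eq_abs]; exact Ψ.abs_perVarPressure_sub_perVarPressure_beta_le q R (βs k) β) h0

end FermionInteraction

/-! ### §2. Linear families of couplings: convexity and Lipschitz continuity in `θ` -/

section LinearFamily

variable {ι : Type*} [Fintype ι] (Ψ₀ : FermionInteraction d) (Ψv : ι → FermionInteraction d) (β : ℝ) (q : Fin d → ℕ) (R : ℝ)

/-- **`θ ↦ P_q(β, Ψ₀ + Σ θ_a Ψ_a)` is CONVEX** (a supremum of affine functions of `θ`). [cite: Israel1979, Thm. I.3.4] -/
theorem convexOn_perVarPressure_linearFamily :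
    ConvexOn ℝ Set.univ fun θ : ι → ℝ => (FermionInteraction.linearFamily Ψ₀ Ψv θ).perVarPressure β q R := by
  refine ⟨convex_univ, fun x _ y _ a b ha hb hab => ?_⟩
  refine (FermionInteraction.linearFamily Ψ₀ Ψv (a • x + b • y)).perVarPressure_le β q R fun ω hω => ?_
  have hx := (FermionInteraction.linearFamily Ψ₀ Ψv x).sub_mul_le_perVarPressure β q R hω
  have hy := (FermionInteraction.linearFamily Ψ₀ Ψv y).sub_mul_le_perVarPressure β q R hω
  rw [InfVolFermionState.cellMeanEnergy_linearFamily Ψ₀ Ψv] at hx hy ⊢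
  set e0 := InfVolFermionState.cellMeanEnergy q Ψ₀ ω R
  set e : ι → ℝ := fun i => InfVolFermionState.cellMeanEnergy q (Ψv i) ω R with he
  have hsum : ∑ i, (a • x + b • y) i * e i = a * ∑ i, x i * e i + b * ∑ i, y i * e i := by
    rw [Finset.mul_sum, Finset.mul_sum, ← Finset.sum_add_distrib]
    refine Finset.sum_congr rfl fun i _ => ?_
    simp only [Pi.add_apply, Pi.smul_apply, smul_eq_mul]
    ring
  have hsum' : ∑ i, (a • x + b • y) i * InfVolFermionState.cellMeanEnergy q (Ψv i) ω R = ∑ i, (a • x + b • y) i * e i := rfl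
  rw [hsum', hsum]
  have eq : ω.entropyDensitySup - β * (e0 + (a * ∑ i, x i * e i + b * ∑ i, y i * e i)) =
      a * (ω.entropyDensitySup - β * (e0 + ∑ i, x i * e i)) + b * (ω.entropyDensitySup - β * (e0 + ∑ i, y i * e i)) := by
    linear_combination (ω.entropyDensitySup - β * e0) * hab.symm
  rw [eq]
  simp only [smul_eq_mul]
  exact add_le_add (mul_le_mul_of_nonneg_left hx ha) (mul_le_mul_of_nonneg_left hy hb)

/-- **Joint Lipschitz bound in the couplings**: `|P_q(β,Ψ(θ)) − P_q(β,Ψ(θ'))| ≤ |β| Σ_a |θ_a − θ'_a| S_q(Ψ_a)`. [cite: Israel1979, Thm. I.3.4] -/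
theorem abs_perVarPressure_linearFamily_sub_le (θ θ' : ι → ℝ) :
    |(FermionInteraction.linearFamily Ψ₀ Ψv θ).perVarPressure β q R - (FermionInteraction.linearFamily Ψ₀ Ψv θ').perVarPressure β q R| ≤
      |β| * ∑ a, |θ a - θ' a| * (Ψv a).cellSiteNorm q R := by
  refine (FermionInteraction.linearFamily Ψ₀ Ψv θ).abs_perVarPressure_sub_le β q R _ R fun ω _ => ?_
  rw [InfVolFermionState.cellMeanEnergy_linearFamily_eq_add_sum_sub_mul Ψ₀ Ψv θ θ' ω R, add_sub_cancel_left]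
  refine (Finset.abs_sum_le_sum_abs _ _).trans (Finset.sum_le_sum fun a _ => ?_)
  rw [abs_mul]
  exact mul_le_mul_of_nonneg_left ((Ψv a).abs_cellMeanEnergy_le_cellSiteNorm q R ω) (abs_nonneg _)

/-- **One-sided Lipschitz / convexity sandwich between grid points**: for `0 ≤ s ≤ 1`,
`P_q(θ + s(θ' − θ)) ≤ (1 − s) P_q(θ) + s P_q(θ')` (convexity). [cite: Israel1979, Thm. I.3.4] -/
theorem perVarPressure_linearFamily_segment_le (θ θ' : ι → ℝ) {s : ℝ} (hs0 : 0 ≤ s) (hs1 : s ≤ 1) :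
    (FermionInteraction.linearFamily Ψ₀ Ψv ((1 - s) • θ + s • θ')).perVarPressure β q R ≤
      (1 - s) * (FermionInteraction.linearFamily Ψ₀ Ψv θ).perVarPressure β q R +
        s * (FermionInteraction.linearFamily Ψ₀ Ψv θ').perVarPressure β q R := by
  have h := (convexOn_perVarPressure_linearFamily Ψ₀ Ψv β q R).2 (Set.mem_univ θ) (Set.mem_univ θ') (sub_nonneg.2 hs1) hs0
    (by ring)
  simpa only [smul_eq_mul] using h

/-- **Joint continuity of `P_q` of a linear family in `(β, θ)`** (sequential form). [cite: Israel1979, Thm. I.3.4] -/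
theorem tendsto_perVarPressure_of_tendsto {βs : ℕ → ℝ} {β : ℝ} (hβ : Tendsto βs atTop (𝓝 β)) {θs : ℕ → ι → ℝ} {θ : ι → ℝ}
    (hθ : ∀ a, Tendsto (fun k => θs k a) atTop (𝓝 (θ a))) :
    Tendsto (fun k => (FermionInteraction.linearFamily Ψ₀ Ψv (θs k)).perVarPressure (βs k) q R) atTop
      (𝓝 ((FermionInteraction.linearFamily Ψ₀ Ψv θ).perVarPressure β q R)) := by
  have h1 := (FermionInteraction.linearFamily Ψ₀ Ψv θ).tendsto_perVarPressure_beta q R hβ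
  have hdiff : Tendsto (fun k => (FermionInteraction.linearFamily Ψ₀ Ψv (θs k)).perVarPressure (βs k) q R -
      (FermionInteraction.linearFamily Ψ₀ Ψv θ).perVarPressure (βs k) q R) atTop (𝓝 0) := by
    have hsum : Tendsto (fun k => |βs k| * ∑ a, |θs k a - θ a| * (Ψv a).cellSiteNorm q R) atTop (𝓝 0) := by
      have hsm : Tendsto (fun k => ∑ a, |θs k a - θ a| * (Ψv a).cellSiteNorm q R) atTop (𝓝 0) := by
        have h := tendsto_finsetSum (Finset.univ : Finset ι) fun a _ =>
          ((tendsto_iff_norm_sub_tendsto_zero.1 (hθ a)).mul_const ((Ψv a).cellSiteNorm q R))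
        simp only [zero_mul, Finset.sum_const_zero] at h
        refine h.congr fun k => Finset.sum_congr rfl fun a _ => ?_
        rw [Real.norm_eq_abs]
      have h := (continuous_abs.tendsto β |>.comp hβ).mul hsm
      rw [mul_zero] at h
      exact h
    exact squeeze_zero_norm (fun k => by
      rw [Real.norm_eq_abs]; exact abs_perVarPressure_linearFamily_sub_le Ψ₀ Ψv (βs k) q R (θs k) θ) hsum
  have h := hdiff.add h1
  rw [zero_add] at h
  exact h.congr fun k => by ring

end LinearFamily

/-! ### §3. The graph of the periodic equilibrium correspondence is closed -/

namespace InfVolFermionState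

variable {q : Fin d → ℕ} {ωs : ℕ → InfVolFermionState d} {ωl : InfVolFermionState d}

/-- **CLOSED GRAPH, general form** (periodic equilibria): equilibrium states `ω_k` at `(β_k, Ψ_k)` converging locally to `ω`, with `β_k → β`,
`P_q(β_k,Ψ_k) → P_q(β,Ψ)` and `ē(Ψ_k)(ω_k) − ē(Ψ)(ω_k) → 0`, give a periodic equilibrium state `ω` at `(β, Ψ)` (`d ≥ 1`).
[cite: Israel1979, Thm. I.2.4] [cite: BratteliRobinsonII1997, Thm. 6.2.40] -/
theorem isPerVarEquilibrium_of_tendsto_general (hd : 0 < d) {βs : ℕ → ℝ} {β : ℝ} {Ψs : ℕ → FermionInteraction d}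
    {Ψ : FermionInteraction d} {Rs : ℕ → ℝ} {R : ℝ}
    (hlim : ∀ (Λ : Finset (Site d)) (A : FermionOp Λ), Tendsto (fun j => (ωs j).expect Λ A) atTop (𝓝 (ωl.expect Λ A)))
    (heq : ∀ j, (ωs j).IsPerVarEquilibrium (βs j) q (Ψs j) (Rs j)) (hβ : Tendsto βs atTop (𝓝 β))
    (hP : Tendsto (fun j => (Ψs j).perVarPressure (βs j) q (Rs j)) atTop (𝓝 (Ψ.perVarPressure β q R)))
    (hE : Tendsto (fun j => cellMeanEnergy q (Ψs j) (ωs j) (Rs j) - cellMeanEnergy q Ψ (ωs j) R) atTop (𝓝 0)) :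
    ωl.IsPerVarEquilibrium β q Ψ R := by
  refine isPerVarEquilibrium_of_tendsto_expect_of_tendsto hd hlim (fun j => (heq j).1) ?_
  have he := tendsto_cellMeanEnergy_of_tendsto_expect hlim q Ψ R
  have hid : ∀ j, (ωs j).entropyDensitySup - β * cellMeanEnergy q Ψ (ωs j) R =
      (Ψs j).perVarPressure (βs j) q (Rs j) + (βs j * (cellMeanEnergy q (Ψs j) (ωs j) (Rs j) - cellMeanEnergy q Ψ (ωs j) R) +
        (βs j - β) * cellMeanEnergy q Ψ (ωs j) R) := fun j => by
    have h := (heq j).2; linarith [h]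
  simp only [hid]
  have h2 : Tendsto (fun j => βs j * (cellMeanEnergy q (Ψs j) (ωs j) (Rs j) - cellMeanEnergy q Ψ (ωs j) R) +
      (βs j - β) * cellMeanEnergy q Ψ (ωs j) R) atTop (𝓝 0) := by
    have ha := hβ.mul hE
    have hb : Tendsto (fun j => (βs j - β) * cellMeanEnergy q Ψ (ωs j) R) atTop (𝓝 0) := by
      have h := (hβ.sub (tendsto_const_nhds (x := β))).mul he
      rw [sub_self, zero_mul] at h
      exact h
    have h := ha.add hb
    rw [mul_zero, zero_add] at h
    exact h
  have h := hP.add h2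
  rw [add_zero] at h
  exact h

/-- **Closed graph in the temperature** (periodic equilibria, same interaction). [cite: Israel1979, Thm. I.2.4] -/
theorem isPerVarEquilibrium_of_tendsto_beta (hd : 0 < d) {βs : ℕ → ℝ} {β : ℝ} {Ψ : FermionInteraction d} {R : ℝ}
    (hlim : ∀ (Λ : Finset (Site d)) (A : FermionOp Λ), Tendsto (fun j => (ωs j).expect Λ A) atTop (𝓝 (ωl.expect Λ A)))
    (heq : ∀ j, (ωs j).IsPerVarEquilibrium (βs j) q Ψ R) (hβ : Tendsto βs atTop (𝓝 β)) : ωl.IsPerVarEquilibrium β q Ψ R :=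
  isPerVarEquilibrium_of_tendsto_general hd hlim heq hβ (Ψ.tendsto_perVarPressure_beta q R hβ)
    (by simp only [sub_self]; exact tendsto_const_nhds)

/-- **Closed graph in `(β, θ)` for a linear family of couplings** (periodic equilibria): equilibrium states at `(β_k, θ_k) → (β, θ)`
converge locally (along subsequences) to equilibrium states at `(β, θ)`. [cite: Israel1979, Thm. I.2.4] [cite: BratteliRobinsonII1997, Thm. 6.2.40] -/
theorem isPerVarEquilibrium_of_tendsto_params (hd : 0 < d) {ι : Type*} [Fintype ι] {Ψ₀ : FermionInteraction d}
    {Ψv : ι → FermionInteraction d} {R : ℝ} {βs : ℕ → ℝ} {β : ℝ} {θs : ℕ → ι → ℝ} {θ : ι → ℝ}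
    (hlim : ∀ (Λ : Finset (Site d)) (A : FermionOp Λ), Tendsto (fun j => (ωs j).expect Λ A) atTop (𝓝 (ωl.expect Λ A)))
    (heq : ∀ j, (ωs j).IsPerVarEquilibrium (βs j) q (FermionInteraction.linearFamily Ψ₀ Ψv (θs j)) R)
    (hβ : Tendsto βs atTop (𝓝 β)) (hθ : ∀ a, Tendsto (fun k => θs k a) atTop (𝓝 (θ a))) :
    ωl.IsPerVarEquilibrium β q (FermionInteraction.linearFamily Ψ₀ Ψv θ) R := by
  refine isPerVarEquilibrium_of_tendsto_general hd hlim heq hβ (tendsto_perVarPressure_of_tendsto Ψ₀ Ψv q R hβ hθ) ?_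
  have hid : ∀ j, cellMeanEnergy q (FermionInteraction.linearFamily Ψ₀ Ψv (θs j)) (ωs j) R -
      cellMeanEnergy q (FermionInteraction.linearFamily Ψ₀ Ψv θ) (ωs j) R = ∑ a, (θs j a - θ a) * cellMeanEnergy q (Ψv a) (ωs j) R :=
    fun j => by
    rw [cellMeanEnergy_linearFamily_eq_add_sum_sub_mul Ψ₀ Ψv (θs j) θ (ωs j) R, add_sub_cancel_left]
  simp only [hid]
  have hterm : ∀ a : ι, Tendsto (fun j => (θs j a - θ a) * cellMeanEnergy q (Ψv a) (ωs j) R) atTop (𝓝 0) := by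
    intro a
    have hg : Tendsto (fun j => ‖θs j a - θ a‖ * (Ψv a).cellSiteNorm q R) atTop (𝓝 0) := by
      have h := (tendsto_iff_norm_sub_tendsto_zero.1 (hθ a)).mul_const ((Ψv a).cellSiteNorm q R)
      rwa [zero_mul] at h
    refine squeeze_zero_norm (fun j => ?_) hg
    rw [norm_mul, Real.norm_eq_abs, Real.norm_eq_abs]
    exact mul_le_mul_of_nonneg_left ((Ψv a).abs_cellMeanEnergy_le_cellSiteNorm q R (ωs j)) (abs_nonneg _)
  have h := tendsto_finsetSum (Finset.univ : Finset ι) fun a _ => hterm a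
  simp only [Finset.sum_const_zero] at h
  exact h

/-! ### §4. Entropy densities of periodic equilibrium states from pressures -/

/-- **The mean entropy of a periodic equilibrium state from three pressures** (`β ≥ 0`, `δ > 0`): `s̄(ω) = P_q(β) + β ē(ω)` and the energy
window in `β` give `s̄(ω) ∈ [P_q(β) + β(P_q(β) − P_q(β+δ))/δ, P_q(β) + β(P_q(β−δ) − P_q(β))/δ]`. [cite: Israel1979, Thm. I.2.4] -/
theorem IsPerVarEquilibrium.entropyDensitySup_mem_Icc {β : ℝ} (hβ : 0 ≤ β) {Ψ : FermionInteraction d} {R : ℝ} {ω : InfVolFermionState d}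
    (h : ω.IsPerVarEquilibrium β q Ψ R) {δ : ℝ} (hδ : 0 < δ) :
    ω.entropyDensitySup ∈ Set.Icc
      (Ψ.perVarPressure β q R + β * ((Ψ.perVarPressure β q R - Ψ.perVarPressure (β + δ) q R) / δ))
      (Ψ.perVarPressure β q R + β * ((Ψ.perVarPressure (β - δ) q R - Ψ.perVarPressure β q R) / δ)) := by
  have hw := h.cellMeanEnergy_mem_Icc_beta hδ
  have hs : ω.entropyDensitySup = Ψ.perVarPressure β q R + β * cellMeanEnergy q Ψ ω R := by
    have h2 := h.2; linarith
  rw [hs]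
  exact ⟨by nlinarith [hw.1], by nlinarith [hw.2]⟩

end InfVolFermionState

end Literature.MathematicalPhysics.QuantumLattice

end
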